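import Literature.MathematicalPhysics.QuantumFieldTheory.Balaban1983to89.B2Lemma24KerOmegaTorusShift

/-!
# [B2] Lemma 2.4 p. 572 — NON-VACUITY OF THE LEMMA 2.4 MODEL FAMILIES: every frame with `m²₊ ≥ 0` and room for one
# box carries a `B2Lemma24KerOmegaTorusShift.ModelW` (hence a `ModelV`, `ModelT`, `ModelS`, `ModelR` and gen 5's
# `B2Lemma24Proof.Model` along the lineage's maps) whose member of the row's family SATISFIES the restrictions (2.55);
# and such a frame exists over every flow `U(t) = e^{tq}` — so `B2.Lemma24Printed (famOfW fr)` and its ancestors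
# quantify over inhabited families with members inside the (2.55) hypothesis

statement-level skeleton of published theorems with citation tags; proofs where landed; nothing here is a claim about
the Yang–Mills mass gap

CITATION HEADER (lean-in-tree rule).  T. Bałaban, *(Higgs)₂,₃ quantum fields in a finite volume. II. An upper bound*,
Commun. Math. Phys. **86** (1982) 555–594, doi:10.1007/bf01214890 [Balaban1982Higgs2] («B2»): (2.55)–(2.56) p. 570,
Proposition 2.2 (2.58) pp. 570–571, Lemma 2.4 (2.65)–(2.66) and its proof p. 572; T. Bałaban, *Regularity and decay of
lattice Green's functions*, Commun. Math. Phys. **89** (1983) 571–597 [Balaban1983RegularityDecay] («B4»): (1.2) p. 572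
«U(A) = e^{qeηA}, q is an antisymmetric N × N matrix», p. 572 «a rectangular parallelepiped … with periodic conditions»,
p. 575 «a sum of large blocks, i.e. blocks of the size M on the unit lattice».  Cell `lit-balaban` (HOME `run/shared/lean/pub/lit-balaban/`), Phase-2 proof seat **p23** gen 20
(unit `lit-balaban-p23-g20`, literature-prover-lit-balaban-p23-g20-0); SKELETON row **B2.Lem2.4** — CELLS ONLY (head
`proved p250408 · p336252 · p340291 · p341404` FINAL, unchanged; fold owner r02, second reader r14, referee ref-4; r02's
B2-CLOSURE §32 (K5) «non-vacuity witness welcome, not required»).  A NEW LEAF over `B2Lemma24KerOmegaTorusShift`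
(p343655/p344414); nothing restated, no definition of the lineage touched, no hypothesis added anywhere.  v1 = p345843;
**v1.1 (same gen) APPEND-ONLY §4**: the same witness for the regions family on `ηℤ^{d+1}` (`B2Lemma24KerOmega.ModelU`,
head pid p340291) — §§1–3 byte-identical.

WHAT IS PRINTED (p. 572).  «Lemma 2.4. Under the restrictions (2.55) we have (2.65), (2.66)» for
`φ^{(k)} = a_kG_k(Ω, A^{(k)})Q_k^*(A^{(k)})φ` of (2.56) p. 570, `Ω = B^k(Λ₂^{(k−1)′})`, `y ∈ Λ₇^{(k−1)′}`.  The tree's decl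
of record `B2.Lemma24Printed fam := ∃ C, ∀ i, (fam i).restr255 → dev265a/dev265b/dev266 ≤ C·p` is proved for MODEL
FAMILIES — gen 5's `famOf fr Yo` over `B2Lemma24Proof.Model` (p250408), r04's `famOfR` (p336252), p23's `famOfU`
(p340291), `famOfV` (p341404), `famOfW` (p343655) — whose instance types carry the printed inputs as some seventy fields
(data, the (2.23)/(1.7) regularity of `A^{(k)}`, smallness of `e(L^kε)` below three thresholds and `θ_S ≤ 1`, the geometry
of `□₂ ⊂ Λ₂′`, `□₁ ⊂ Λ₆′`, depth `R ≥ R₀`, big-block divisibilities, the scale products `e^{−δR}t_φ ≤ K`, …).  A statement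
of the shape `∃ C, ∀ i, restr255 i → …` is vacuous over an EMPTY index type, and void for a member failing `restr255`;
this file closes that doubt for the torus families.

WHAT THIS FILE PROVES (kernel-checked, 0 sorry; every declaration carries a `[cite: …]` tag, dictionary-tagged where the content
is bookkeeping).
 §1 `modelR_restr_of_single`: for ANY `ModelR` (r04's instance type) with `□₁ = {y}`, (2.55) (`ModelR.Restr`) reduces to
    the bound `|φ(y′)| ≤ t_φ·q` on `Λ₆′` — the integrated covariant Lipschitz clause (2.55)₃ is asked only between `y` and
    itself, where the constant-field transporter `U(κA₀(Γ_{y,y})) = U(0) = 1`.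
 §2 For EVERY frame `fr : FrameV ι d` with `0 ≤ m²₊` and ROOM `K·(2R+1) ≤ S` for some natural `R ≥ max(1, R₀)`
    (`K = fr.KV1` the big-block modulus, `R₀ = fr.rT1` of (2.58) on the torus, `S = fr.S` the box-size bound):
    **`witnessW`** — an explicit `ModelW fr` (`k = 1`, `(a, m²) = (a₋, 0)`, `□₂ = Π[0, K(2R+1))` at the corner `o = 0` of
    the torus `Π_ν ℤ/(L·K(2R+2))`, `Ω = Λ₂′ = Λ₆′ =` all unit labels of the torus, CONSTANT component field `A ≡ c` (any
    `c ∈ ℝ^{d+1}`), coupling `e₀ = min(e_NC, e_T, e_R, e_θ)` with `e_θ = (2(d+1)²Sc_reg + 1)^{−1/β}` so that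
    `(d+1)θ_S(e₀) ≤ 1` (`tau_e0_le`), block point `y = (R,…,R)`, `□₁ = {y}`, `φ ≡ 0`, scales `p = q = t_φ = R₁ = R₂ = R₄ = 0`,
    depth `R`; the depth inequalities `deep_of_blkSite` from `x_i / L = R`); **`witnessW_restr255`**: its member of the
    row's family satisfies `restr255`; `modelW_nonempty`, `modelV_nonempty`, `exists_member_restr255`
    (`∃ m : ModelW fr, m.Ac = (fun _ => c) ∧ (famOfW fr m).restr255`), `witnessW_modelR_restr`, and **`model_nonempty`**:
    gen 5's `B2Lemma24Proof.Model fr.toFrame Yo` is inhabited for some finite `Yo` (the witness carried down `toModelV`,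
    `toModelT`, `toModelS`, `toModelR`, `ModelR.toModel`).  `sixteen_le_KV1`/`KV1_pos` record r01's `K ≥ 16`.
 §3 **`frame0`** — a base `Frame ι d` over the flow `expFlow q hq` (`U(t) = e^{tq}`, ANY antisymmetric `q`, its Lipschitz
    modulus `(Σ q_{ij}²)^{1/2}` by `B4Eq12ExpFlow.expFlow_lipschitz`), window `a₋ = a₊ = 1`, `m²₊ = 1`, free constants `0`;
    **`frameV0`** = `frame0` upgraded along `FrameR.ofFrame`, `FrameS.ofFrameR` with `S := K(2R+1)`, `R := max(1, ⌈R₀⌉)`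
    (`R0`, `S0` — computable from the base data since `K` and `R₀` do not depend on `S`), `FrameV.ofFrameS`; and the
    UNCONDITIONAL **`modelW_nonempty_frameV0`**, **`exists_member_restr255_frameV0`**, **`model_nonempty_frameV0`**: for
    every finite nonempty `ι`, antisymmetric `q`, `d ≥ 1`, `ℓ ≥ 1`, `c_reg ≥ 0`, `β > 0` the torus family over `frameV0`
    has a member obeying (2.55), and gen 5's `Model` over `frameV0.toFrame` is inhabited.
 §4 (v1.1) THE REGIONS FAMILY ON `ηℤ^{d+1}`: for every `fr : FrameU ι d` with `0 ≤ m²₊` and room `K(2R+1) ≤ S`,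
    `R ≥ max(1, R₀)` (`K = fr.KP1`, `R₀ = fr.rP1` of (2.58) for region pairs): **`witnessU : ModelU fr`** (`Ω = □₂ =
    Π[0, K(2R+1)) ⊂ ηℤ^{d+1}` ITSELF at `o = 0` — `□ = B^k(Λ₂′)`, a union of big blocks —, `Λ₆′ = Λ₂′`, `A ≡ c`,
    `e₀ = min(e_NC, e_P, e_θ)`, `y = (R,…,R)`, `□₁ = {y}`, `φ ≡ 0`, scales `0`, depth `R`), **`witnessU_restr255`**
    (`(famOfU fr w).restr255`), `exists_memberU_restr255`, `modelU_nonempty`; and over `e^{tq}` the `FrameU` with room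
    **`frameU0`** (`FrameU.ofFrameS`, `S := K(2R+1)`, `R0U`, `S0U`) with the UNCONDITIONAL **`exists_memberU_restr255_frameU0`**.

HONEST SCOPE.  (a) The witness is DEGENERATE BY DESIGN (`φ ≡ 0`, `t_φ = p = q = 0`, constant `A`, `Ω =` the whole torus,
`k = 1`): it certifies that the hypothesis fields of `ModelW` — and, along the maps, of `ModelV`/`ModelT`/`ModelS`/`ModelR`/
`Model`, and (§4) of `ModelU` — are JOINTLY SATISFIABLE together with (2.55), i.e. that the row's theorems quantify over inhabited families with
members inside the hypothesis; for this member the conclusion of `B2.Lemma24Printed` reads `dev ≤ C·0`.  It is NOT the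
print's intended instance (`y ∈ Λ₇′`, the `4r`/`2r` cubes, the minimizer's `A^{(k)}`, `φ` with
`t_φ = c₁λ(L^{k−1}ε)^{−1/4} > 0`), whose derivation inside the kernel remains the located residue of the row (r02
B2-CLOSURE §32k) and a successor item.  (b) Generality: `0 ≤ m²₊` is NECESSARY (a `Frame` with `m²₊ < 0` has no instance —
the window `0 ≤ m² ≤ m²₊` is empty; `Frame` does not exclude it), and the room hypothesis is met by every frame built
along the `of…` maps with `S` chosen after `K`, `R₀` (§3); a frame with `S < K` has no instance either (`K ∣ M ≤ S`).
(c) With `t_φ = 0` the scale products hold on every frame (`K_i ≥ 0`); a witness with `t_φ > 0` needs `K₁, K₂, K₄, K₅ > 0`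
and is not attempted.  (d) Nothing here bears on the head or on any estimate; zero row weight.
-/

namespace Literature.MathematicalPhysics.QuantumFieldTheory.Balaban1983to89.B2Lemma24ModelWitness

open Finset Matrix
open Literature.MathematicalPhysics.QuantumFieldTheory.Balaban1983to89.B4GaugeCovariance
open Literature.MathematicalPhysics.QuantumFieldTheory.Balaban1983to89.B4TorusPositivity (wrap)
open Literature.MathematicalPhysics.QuantumFieldTheory.Balaban1983to89.B4Lower18 (fineDom IsBlockUnion
  boxDom_isBlockUnion)
open Literature.MathematicalPhysics.QuantumFieldTheory.Balaban1983to89.B4Lower18Regular (e1)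
open Literature.MathematicalPhysics.QuantumFieldTheory.Balaban1983to89.B4Lemma21Region (siteNorm)
open Literature.MathematicalPhysics.QuantumFieldTheory.Balaban1983to89.B4Reflection242 (boxDom mem_boxDom blk
  blk_mem_boxDom)
open Literature.MathematicalPhysics.QuantumFieldTheory.Balaban1983to89.B4ContourShift (supNorm supNorm_nonneg)
open Literature.MathematicalPhysics.QuantumFieldTheory.Balaban1983to89.B4Lemma22ReduceZero (Box)
open Literature.MathematicalPhysics.QuantumFieldTheory.Balaban1983to89.B4TorusRegionOp
open Literature.MathematicalPhysics.QuantumFieldTheory.Balaban1983to89.B2Eq268GaugeAway (blkSite)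
open Literature.MathematicalPhysics.QuantumFieldTheory.Balaban1983to89.B2Lemma24Proof
open Literature.MathematicalPhysics.QuantumFieldTheory.Balaban1983to89.B2Lemma24RemD
open Literature.MathematicalPhysics.QuantumFieldTheory.Balaban1983to89.B2Lemma24SupG
open Literature.MathematicalPhysics.QuantumFieldTheory.Balaban1983to89.B2Lemma24KerOmega
open Literature.MathematicalPhysics.QuantumFieldTheory.Balaban1983to89.B2Lemma24KerOmegaTorus
open Literature.MathematicalPhysics.QuantumFieldTheory.Balaban1983to89.B2Lemma24KerOmegaTorusShift
open Literature.MathematicalPhysics.QuantumFieldTheory.Balaban1983to89.B4Eq12ExpFlow (expFlow expFlow_lipschitz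
  expFlow_ell_nonneg)

noncomputable section

variable {d : ℕ} {ι : Type} [Fintype ι] [DecidableEq ι]

/-! ## §1 The restrictions (2.55) of a member whose `□₁` is the single block `{y}` -/

/-- for a member with `□₁ = {y}`, (2.55) reduces to the bound `|φ(y′)| ≤ t_φ·p(L^{k−1}ε)` on `Λ₆′`: the integrated
covariant Lipschitz clause (2.55)₃ is only asked between `y` and itself, where the constant-field transporter is `1`.
[cite: Balaban1982Higgs2, (2.55) p. 570, dictionary] -/
theorem modelR_restr_of_single {fr : FrameR ι d} {Yo : Type} [Fintype Yo] [DecidableEq Yo] (m : ModelR fr Yo)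
    (hsq : m.sq1 = {m.y}) (hφ : ∀ y' ∈ m.Tout, siteNorm (m.φΩ y') ≤ m.tφ * m.q) : m.Restr := by
  refine ⟨hφ, ?_⟩
  intro x _ x' hx'
  rw [hsq, Finset.mem_singleton] at hx'
  rw [hx']
  have h1 : fieldLink fr.F m.κ (constBond m.A₀ Subtype.val) (m.emb m.y) (m.emb m.y) = 1 := by
    simp only [fieldLink, constBond, sub_self, mul_zero, Finset.sum_const_zero]
    exact fr.F.map_zero
  rw [h1, Matrix.one_mulVec, sub_self, B4Lemma22Reduce231.siteNorm_zero]
  exact mul_nonneg m.q_nonneg (add_nonneg fr.r₁_nonneg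
    (mul_nonneg fr.r₂_nonneg (div_nonneg (supNorm_nonneg _) (Nat.cast_nonneg _))))

/-! ## §2 A `ModelW` on every frame with room for one box -/

section General

variable [Nonempty ι] (fr : FrameV ι d)

/-- the big blocks of a frame have size `K ≥ 16` (r01's `Kmod`). [cite: Balaban1983RegularityDecay, p. 575 «large blocks, i.e. blocks of the size M», dictionary] -/
theorem sixteen_le_KV1 : 16 ≤ fr.KV1 :=
  (Classical.choose_spec (B4ThmRegionPairEta.region_pair_members fr.F fr.hℓ₁ fr.hLip d fr.ℓ fr.hℓ fr.amin fr.aplus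
    fr.m2plus fr.ha)).1

/-- `K > 0` (the form `1 ≤ K` is `B2Lemma24KerOmegaTorusShift.ModelW.hK1`, which presupposes an instance).
[cite: Balaban1983RegularityDecay, p. 575 «large blocks, i.e. blocks of the size M», dictionary] -/
theorem KV1_pos : 0 < fr.KV1 := lt_of_lt_of_le (by norm_num) (sixteen_le_KV1 fr)

/-- the smallness threshold `e_θ = (2(d+1)²·S·c_reg + 1)^{−1/β}` making `(d+1)·θ_S(e_θ) ≤ 1`.
[cite: Balaban1982Higgs2, Lemma 2.4 p. 572 «O((L^kε)^{κ₀})», dictionary] -/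
def eθ : ℝ := (1 / (2 * ((d : ℝ) + 1) ^ 2 * fr.S * fr.creg + 1)) ^ (1 / fr.β)

/-- the base of `e_θ` is positive. [cite: Balaban1982Higgs2, Lemma 2.4 p. 572, dictionary] -/
theorem eθ_base_pos : 0 < 2 * ((d : ℝ) + 1) ^ 2 * fr.S * fr.creg + 1 := by
  have := fr.hcreg
  positivity

/-- `e_θ > 0`. [cite: Balaban1982Higgs2, Lemma 2.4 p. 572, dictionary] -/
theorem eθ_pos : 0 < eθ fr := by
  unfold eθ
  exact Real.rpow_pos_of_pos (by have := eθ_base_pos fr; positivity) _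

/-- `e_θ^β = 1/(2(d+1)²·S·c_reg + 1)`. [cite: Balaban1982Higgs2, Lemma 2.4 p. 572, dictionary] -/
theorem rpow_eθ : (eθ fr) ^ fr.β = 1 / (2 * ((d : ℝ) + 1) ^ 2 * fr.S * fr.creg + 1) := by
  unfold eθ
  rw [← Real.rpow_mul (le_of_lt (by have := eθ_base_pos fr; positivity)), one_div_mul_cancel fr.hβ.ne',
    Real.rpow_one]

/-- `(d+1)·θ_S(e_θ) ≤ 1`. [cite: Balaban1982Higgs2, Lemma 2.4 p. 572 «O((L^kε)^{κ₀})», dictionary] -/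
theorem tau_eθ_le : ((d : ℝ) + 1) * thetaS d fr.S fr.creg fr.β (eθ fr) ≤ 1 := by
  have hD0 : 0 ≤ 2 * ((d : ℝ) + 1) ^ 2 * fr.S * fr.creg := by have := fr.hcreg; positivity
  rw [thetaS, rpow_eθ]
  rw [show ((d : ℝ) + 1) * (2 * ((d : ℝ) + 1) * (fr.S : ℝ) * fr.creg
      * (1 / (2 * ((d : ℝ) + 1) ^ 2 * fr.S * fr.creg + 1)))
      = (2 * ((d : ℝ) + 1) ^ 2 * fr.S * fr.creg) / (2 * ((d : ℝ) + 1) ^ 2 * fr.S * fr.creg + 1) by ring]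
  exact (div_le_one (eθ_base_pos fr)).2 (by linarith)

/-- `θ_S` is monotone in `e ≥ 0`. [cite: Balaban1982Higgs2, Lemma 2.4 p. 572, dictionary] -/
theorem thetaS_mono {e e' : ℝ} (he : 0 ≤ e) (h : e ≤ e') :
    thetaS d fr.S fr.creg fr.β e ≤ thetaS d fr.S fr.creg fr.β e' := by
  unfold thetaS
  have h1 : e ^ fr.β ≤ e' ^ fr.β := Real.rpow_le_rpow he h fr.hβ.le
  have hc : 0 ≤ 2 * ((d : ℝ) + 1) * (fr.S : ℝ) * fr.creg := by have := fr.hcreg; positivity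
  exact mul_le_mul_of_nonneg_left h1 hc

/-- the coupling of the witness: below the three thresholds of the frame and below `e_θ`.
[cite: Balaban1982Higgs2, Prop. 2.2 p. 570 «for e(L^kε) sufficiently small», dictionary] -/
def e0 : ℝ := min (min fr.eNC1 fr.eT1) (min fr.eR1 (eθ fr))

/-- `e₀ > 0`. [cite: Balaban1982Higgs2, Prop. 2.2 p. 570, dictionary] -/
theorem e0_pos : 0 < e0 fr :=
  lt_min (lt_min (eNC_spec fr.F fr.hℓ₁ fr.hLip d fr.ℓ fr.hℓ fr.amin fr.aplus fr.m2plus fr.ha fr.creg fr.β fr.hcreg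
      fr.hβ fr.S).1
    (T_spec fr.F fr.hℓ₁ fr.hLip d fr.ℓ fr.hℓ fr.amin fr.aplus fr.m2plus fr.ha fr.creg fr.β fr.hcreg fr.hβ).2.2.2.1)
    (lt_min (R_spec fr.F fr.hℓ₁ fr.hLip d fr.ℓ fr.hℓ fr.amin fr.aplus fr.m2plus fr.ha fr.creg fr.β fr.hcreg fr.hβ).2.2.1
      (eθ_pos fr))

/-- `(d+1)·θ_S(e₀) ≤ 1`. [cite: Balaban1982Higgs2, Lemma 2.4 p. 572, dictionary] -/
theorem tau_e0_le : ((d : ℝ) + 1) * thetaS d fr.S fr.creg fr.β (e0 fr) ≤ 1 :=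
  le_trans (mul_le_mul_of_nonneg_left
    (thetaS_mono fr (e0_pos fr).le ((min_le_right _ _).trans (min_le_right _ _))) (by positivity)) (tau_eθ_le fr)

/-- `θ_S(e₀) ≤ 1`. [cite: Balaban1982Higgs2, Lemma 2.4 p. 572, dictionary] -/
theorem theta_e0_le : thetaS d fr.S fr.creg fr.β (e0 fr) ≤ 1 :=
  le_trans (le_mul_of_one_le_left (thetaS_nonneg d fr.S fr.hcreg (e0_pos fr)) (by linarith [Nat.cast_nonneg (α := ℝ) d]))
    (tau_e0_le fr)

/-- the unit box `□₂` of the witness: `K(2R+1)` unit sites a side. [cite: Balaban1982Higgs2, p. 572 «□₂ … sums of large blocks», dictionary] -/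
def MW (R : ℕ) : Fin (d + 1) → ℕ := fun _ => fr.KV1 * (2 * R + 1)

/-- the torus of the witness: `K(2R+2)` unit sites around. [cite: Balaban1983RegularityDecay, p. 572 «a torus T_η … with periodic conditions», dictionary] -/
def PW (R : ℕ) : Fin (d + 1) → ℕ := fun _ => fr.KV1 * (2 * R + 2)

/-- `M_i ≥ 1`. [cite: Balaban1982Higgs2, Lemma 2.4 p. 572, dictionary] -/
theorem one_le_MW (R : ℕ) (i : Fin (d + 1)) : 1 ≤ MW fr R i :=
  Nat.one_le_iff_ne_zero.2 (Nat.mul_ne_zero (by have := Nat.succ_le_of_lt (KV1_pos fr); omega) (by omega))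

/-- `M_i ≥ 3`. [cite: Balaban1982Higgs2, Lemma 2.4 p. 572, dictionary] -/
theorem three_le_MW (R : ℕ) (i : Fin (d + 1)) : 3 ≤ MW fr R i := by
  have hK := sixteen_le_KV1 fr
  show 3 ≤ fr.KV1 * (2 * R + 1)
  nlinarith

/-- `M_i < P_i` (a proper sub-box). [cite: Balaban1982Higgs2, Lemma 2.4 p. 572, dictionary] -/
theorem MW_lt_PW (R : ℕ) (i : Fin (d + 1)) : MW fr R i < PW fr R i :=
  Nat.mul_lt_mul_of_pos_left (by omega) (Nat.succ_le_of_lt (KV1_pos fr))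

/-- `P_ν ≥ 1`. [cite: Balaban1983RegularityDecay, p. 572, dictionary] -/
theorem one_le_PW (R : ℕ) (ν : Fin (d + 1)) : 1 ≤ PW fr R ν :=
  le_of_lt (lt_of_le_of_lt (one_le_MW fr R ν) (MW_lt_PW fr R ν))

/-- the block point `y = (R, …, R)` of the witness. [cite: Balaban1982Higgs2, Lemma 2.4 p. 572 «y ∈ Λ₇^{(k−1)′}», dictionary] -/
def yW (R : ℕ) : ↥(boxDom (MW fr R)) :=
  ⟨fun _ => (R : ℤ), by
    rw [mem_boxDom]
    intro i
    refine ⟨Int.natCast_nonneg R, ?_⟩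
    show (R : ℤ) < ((fr.KV1 * (2 * R + 1) : ℕ) : ℤ)
    have hK : (1 : ℤ) ≤ fr.KV1 := by exact_mod_cast Nat.succ_le_of_lt (KV1_pos fr)
    have hR : (0 : ℤ) ≤ R := Int.natCast_nonneg R
    push_cast
    nlinarith⟩

/-- the coordinates of `y`. [cite: Balaban1982Higgs2, Lemma 2.4 p. 572, dictionary] -/
@[simp] theorem yW_val (R : ℕ) (i : Fin (d + 1)) : (yW fr R).1 i = R := rfl

/-- the base point `x₀ = 0` of the fine box. [cite: Balaban1982Higgs2, Lemma 2.4 p. 572, dictionary] -/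
def x0W (R : ℕ) : ↥(Box d fr.ℓ 1 (MW fr R)) :=
  ⟨fun _ => 0, by
    rw [mem_boxDom]
    intro i
    refine ⟨le_rfl, ?_⟩
    have h1 : 1 ≤ (fr.ℓ + 1) ^ 1 * MW fr R i := Nat.mul_pos (Nat.one_le_pow _ _ (Nat.succ_pos _)) (one_le_MW fr R i)
    exact_mod_cast h1⟩

/-- the label of a fine point in the block of `y` has all coordinates in `[RL, (R+1)L)`. (`x_i / L = R` for the points of the block of `y`). [cite: Balaban1982Higgs2, Lemma 2.4 p. 572 «x ∈ B^k(y)», dictionary] -/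
theorem deep_of_blkSite (R : ℕ) (x : ↥(Box d fr.ℓ 1 (MW fr R))) (hx : blkSite d fr.ℓ 1 (MW fr R) x = yW fr R)
    (i : Fin (d + 1)) :
    ((R * (fr.ℓ + 1) ^ 1 : ℕ) : ℤ) ≤ x.1 i ∧
      x.1 i + (R * (fr.ℓ + 1) ^ 1 : ℕ) + 1 ≤ (((fr.ℓ + 1) ^ 1 * MW fr R i : ℕ) : ℤ) := by
  have hb : x.1 i / (((fr.ℓ + 1) ^ 1 : ℕ) : ℤ) = R := by
    have := congrArg (fun y : ↥(boxDom (MW fr R)) => y.1 i) hx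
    exact this
  have hn : (0 : ℤ) < (((fr.ℓ + 1) ^ 1 : ℕ) : ℤ) := by positivity
  have h1 : (((fr.ℓ + 1) ^ 1 : ℕ) : ℤ) * (x.1 i / (((fr.ℓ + 1) ^ 1 : ℕ) : ℤ)) ≤ x.1 i := Int.mul_ediv_self_le hn.ne'
  have h3 : x.1 i < (((fr.ℓ + 1) ^ 1 : ℕ) : ℤ) * (x.1 i / (((fr.ℓ + 1) ^ 1 : ℕ) : ℤ)) + (((fr.ℓ + 1) ^ 1 : ℕ) : ℤ) :=
    Int.lt_mul_ediv_self_add hn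
  rw [hb] at h1 h3
  have hK : (1 : ℤ) ≤ fr.KV1 := by exact_mod_cast Nat.succ_le_of_lt (KV1_pos fr)
  have hK' : (((fr.ℓ + 1) ^ 1 : ℕ) : ℤ) * (2 * R + 1) ≤ (((fr.ℓ + 1) ^ 1 : ℕ) : ℤ) * (fr.KV1 * (2 * R + 1)) :=
    mul_le_mul_of_nonneg_left (le_mul_of_one_le_left (by positivity) hK) hn.le
  show _ ∧ _ ≤ ((((fr.ℓ + 1) ^ 1 * (fr.KV1 * (2 * R + 1)) : ℕ) : ℤ))
  push_cast at h1 h3 hn hK' ⊢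
  simp only [pow_one] at h1 h3 hn hK' ⊢
  constructor
  · nlinarith
  · nlinarith

/-- **THE WITNESS**: on a frame with `m²₊ ≥ 0` and room `K(2R+1) ≤ S` for some `R ≥ max(1, R₀)`, the instance with
`k = 1`, `(a, m²) = (a₋, 0)`, `□₂ = Π[0, K(2R+1))` at the corner `o = 0` of the torus `Π ℤ/(L·K(2R+2))`, `Ω = Λ₂′ = Λ₆′ =`
the whole torus, the CONSTANT component field `A ≡ c`, the coupling `e₀`, the block point `y = (R,…,R)`, `□₁ = {y}`,
`φ ≡ 0`, all scales `p = q = t_φ = R₁ = R₂ = R₄ = 0`, depth `R`.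
[cite: Balaban1982Higgs2, (2.55)–(2.56) p. 570, Lemma 2.4 p. 572, dictionary] -/
def witnessW (hm : 0 ≤ fr.m2plus) {R : ℕ} (hR1 : 1 ≤ R) (hRT : fr.rT1 ≤ R) (hS : fr.KV1 * (2 * R + 1) ≤ fr.S)
    (c : Fin (d + 1) → ℝ) : ModelW fr where
  k := 1
  hk := le_rfl
  a := fr.amin
  m2 := 0
  ha1 := le_rfl
  ha2 := fr.hwin
  hm1 := le_rfl
  hm2 := hm
  M := MW fr R
  hM := one_le_MW fr R
  hMS := fun _ => hS
  hM3 := fun i => le_trans (three_le_MW fr R i) (Nat.le_mul_of_pos_left _ (Nat.one_le_pow _ _ (Nat.succ_pos _)))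
  P := PW fr R
  hKP := fun _ => Dvd.intro _ rfl
  o := 0
  hKo := fun _ => dvd_zero _
  hKM := fun _ => Dvd.intro _ rfl
  hMP := MW_lt_PW fr R
  Ω₀T := boxDom (PW fr R)
  hΩP := Finset.Subset.refl _
  hbox := fun y => wrap_mem_boxDom _ (one_le_PW fr R) _
  hbigΩ := boxDom_isBlockUnion (Nat.succ_le_of_lt (KV1_pos fr)) _
  e := e0 fr
  he := e0_pos fr
  hle := (min_le_left _ _).trans (min_le_left _ _)
  hleT := (min_le_left _ _).trans (min_le_right _ _)
  hleR := (min_le_right _ _).trans (min_le_left _ _)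
  hθ1 := theta_e0_le fr
  hτ1 := tau_e0_le fr
  Ac := fun _ => c
  hreg := by
    intro x _ μ ν
    simp only [sub_self, abs_zero]
    exact div_nonneg (mul_nonneg fr.hcreg (Real.rpow_nonneg (e0_pos fr).le _)) (Nat.cast_nonneg _)
  x₀ := x0W fr R
  y := yW fr R
  sq1 := {yW fr R}
  y_mem := Finset.mem_singleton_self _
  φΩ := fun _ _ => 0
  p := 0
  q := 0
  tφ := 0
  R₁ := 0
  R₂ := 0
  R₄ := 0
  p_nonneg := le_rfl
  q_nonneg := le_rfl
  tφ_nonneg := le_rfl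
  R₂_nonneg := le_rfl
  q_le := by rw [mul_zero]
  kap := by rw [mul_zero]; exact fr.K₁_nonneg
  sepG := by rw [mul_zero]; exact fr.K₂_nonneg
  sepD := by rw [mul_zero]; exact fr.K₂_nonneg
  sepO₂ := by rw [mul_zero]; exact fr.K₄_nonneg
  sepO₄ := by rw [mul_zero]; exact fr.K₅_nonneg
  θ_scale := by rw [mul_zero]; exact fr.Kθ_nonneg
  τ_scale := by rw [mul_zero]; exact fr.Kτ_nonneg
  θ'_scale := by rw [mul_zero]; exact fr.Kθ'_nonneg
  far1 := fun _ _ _ _ => div_nonneg (supNorm_nonneg _) (Nat.cast_nonneg _)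
  Tout := Finset.univ
  inc_mem := fun _ _ => Finset.mem_univ _
  farΩ := fun _ _ _ _ _ => tnorm_nonneg _ _ _
  R := R
  hR1 := hR1
  deep := deep_of_blkSite fr R
  hRT := hRT
  hR4 := Nat.cast_nonneg _

/-- the witness has the constant component field `A ≡ c`. [cite: Balaban1982Higgs2, (2.55) p. 570, dictionary] -/
theorem witnessW_Ac (hm : 0 ≤ fr.m2plus) {R : ℕ} (hR1 : 1 ≤ R) (hRT : fr.rT1 ≤ R)
    (hS : fr.KV1 * (2 * R + 1) ≤ fr.S) (c : Fin (d + 1) → ℝ) : (witnessW fr hm hR1 hRT hS c).Ac = fun _ => c := rfl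

/-- **THE WITNESS SATISFIES (2.55)**: the member `famOfW fr (witnessW …)` of the row's torus family has `restr255`.
[cite: Balaban1982Higgs2, (2.55) p. 570, Lemma 2.4 p. 572, dictionary] -/
theorem witnessW_restr255 (hm : 0 ≤ fr.m2plus) {R : ℕ} (hR1 : 1 ≤ R) (hRT : fr.rT1 ≤ R)
    (hS : fr.KV1 * (2 * R + 1) ≤ fr.S) (c : Fin (d + 1) → ℝ) : (famOfW fr (witnessW fr hm hR1 hRT hS c)).restr255 :=
  modelR_restr_of_single _ rfl (fun y' _ => by
    show siteNorm (fun _ : ι => (0 : ℝ)) ≤ 0 * 0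
    rw [mul_zero]
    exact le_of_eq (B4Lemma22Reduce231.siteNorm_zero))

/-- **`ModelW fr` IS INHABITED** on every frame with `m²₊ ≥ 0` and room for one box.
[cite: Balaban1982Higgs2, Lemma 2.4 p. 572, dictionary] -/
theorem modelW_nonempty (hm : 0 ≤ fr.m2plus) {R : ℕ} (hR1 : 1 ≤ R) (hRT : fr.rT1 ≤ R)
    (hS : fr.KV1 * (2 * R + 1) ≤ fr.S) : Nonempty (ModelW fr) := ⟨witnessW fr hm hR1 hRT hS 0⟩

/-- **`ModelV fr` IS INHABITED** (through `ModelW.toModelV`). [cite: Balaban1982Higgs2, Lemma 2.4 p. 572, dictionary] -/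
theorem modelV_nonempty (hm : 0 ≤ fr.m2plus) {R : ℕ} (hR1 : 1 ≤ R) (hRT : fr.rT1 ≤ R)
    (hS : fr.KV1 * (2 * R + 1) ≤ fr.S) : Nonempty (ModelV fr) := ⟨(witnessW fr hm hR1 hRT hS 0).toModelV⟩

/-- the row's torus family has a member obeying (2.55), so `B2.Lemma24Printed (famOfW fr)` binds its constant `C` to an
actual instance. [cite: Balaban1982Higgs2, Lemma 2.4 (2.65)–(2.66) p. 572, dictionary] -/
theorem exists_member_restr255 (hm : 0 ≤ fr.m2plus) {R : ℕ} (hR1 : 1 ≤ R) (hRT : fr.rT1 ≤ R)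
    (hS : fr.KV1 * (2 * R + 1) ≤ fr.S) (c : Fin (d + 1) → ℝ) :
    ∃ m : ModelW fr, m.Ac = (fun _ => c) ∧ (famOfW fr m).restr255 :=
  ⟨_, rfl, witnessW_restr255 fr hm hR1 hRT hS c⟩

/-- down the lineage: the (2.55) predicate of the built `ModelR` (r04's instance type) holds for the witness — the same
statement as `witnessW_restr255`, read through `famOfW = famOfV ∘ toModelV = famOfR ∘ toModelR ∘ toModelS ∘ toModelT ∘ toModelV`.
[cite: Balaban1982Higgs2, (2.55) p. 570, Lemma 2.4 p. 572, dictionary] -/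
theorem witnessW_modelR_restr (hm : 0 ≤ fr.m2plus) {R : ℕ} (hR1 : 1 ≤ R) (hRT : fr.rT1 ≤ R)
    (hS : fr.KV1 * (2 * R + 1) ≤ fr.S) (c : Fin (d + 1) → ℝ) :
    (witnessW fr hm hR1 hRT hS c).toModelV.toModelT.toModelS.toModelR.Restr :=
  witnessW_restr255 fr hm hR1 hRT hS c

/-- **THE INSTANCE TYPE OF THE DECL OF RECORD'S ORIGINAL FAMILY IS INHABITED**: gen 5's `B2Lemma24Proof.Model fr.toFrame Yo`
(the family of `lemma24Printed_model`, head pid p250408) has a member for some finite type of outer sites — the witness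
carried down `toModelV`, `toModelT`, `toModelS`, `toModelR` and r04's `ModelR.toModel` (which consumes (2.55)).
[cite: Balaban1982Higgs2, Lemma 2.4 (2.65)–(2.66) p. 572, dictionary] -/
theorem model_nonempty (hm : 0 ≤ fr.m2plus) {R : ℕ} (hR1 : 1 ≤ R) (hRT : fr.rT1 ≤ R)
    (hS : fr.KV1 * (2 * R + 1) ≤ fr.S) :
    ∃ (Yo : Type) (_ : Fintype Yo) (_ : DecidableEq Yo), Nonempty (Model fr.toFrame Yo) :=
  ⟨_, inferInstance, inferInstance,
    ⟨(witnessW fr hm hR1 hRT hS 0).toModelV.toModelT.toModelS.toModelR.toModel (witnessW_modelR_restr fr hm hR1 hRT hS 0)⟩⟩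

end General

/-! ## §3 A frame with room over every flow `e^{tq}` -/

section Concrete

variable [Nonempty ι] (q : Matrix ι ι ℝ) (hq : qᵀ = -q) (hd : 1 ≤ d) {ℓ : ℕ} (hℓ : 1 ≤ ℓ)
  (creg β : ℝ) (hcreg : 0 ≤ creg) (hβ : 0 < β)

variable (d) in
/-- a base frame over the flow `U(t) = e^{tq}` ([B4] (1.2) «U(A) = e^{qeηA}»): block size `L = ℓ + 1`, window
`a₋ = a₊ = 1`, `m²₊ = 1`, all free constants `0` (`δO = 1`). [cite: Balaban1983RegularityDecay, (1.2) p. 572; Balaban1982Higgs2, Lemma 2.4 p. 572, dictionary] -/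
def frame0 : Frame ι d where
  ℓ := ℓ
  hℓ := hℓ
  F := expFlow q hq
  ℓ₁ := Real.sqrt (∑ i, ∑ j, q i j ^ 2)
  hℓ₁ := expFlow_ell_nonneg q
  hLip := expFlow_lipschitz q hq
  amin := 1
  aplus := 1
  m2plus := 1
  ha := one_pos
  hwin := le_rfl
  cO := 0
  δO := 1
  SO := 0
  cI := 0
  r₁ := 0
  r₂ := 0
  K₁ := 0
  K₂ := 0
  K₃ := 0
  K₄ := 0
  K₅ := 0
  Kθ := 0
  Kτ := 0
  KD := 0
  cO_nonneg := le_rfl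
  δO_pos := one_pos
  SO_nonneg := le_rfl
  cI_nonneg := le_rfl
  r₁_nonneg := le_rfl
  r₂_nonneg := le_rfl
  K₁_nonneg := le_rfl
  K₂_nonneg := le_rfl
  K₃_nonneg := le_rfl
  K₄_nonneg := le_rfl
  K₅_nonneg := le_rfl
  Kθ_nonneg := le_rfl
  Kτ_nonneg := le_rfl
  KD_nonneg := le_rfl

variable (d) in
/-- the depth `R = max(1, ⌈R₀⌉)` for the base data (`R₀` of (2.58) on the torus). [cite: Balaban1982Higgs2, Prop. 2.2 (2.58) p. 570; p. 571 «dist(b, Ω^c) ≧ R₀», dictionary] -/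
def R0 : ℕ :=
  max 1 ⌈rT (expFlow q hq) (expFlow_ell_nonneg q) (expFlow_lipschitz q hq) d ℓ hℓ 1 1 1 one_pos creg β hcreg hβ⌉₊

variable (d) in
/-- the box-size bound `S = K(2R+1)` giving room for one box. [cite: Balaban1982Higgs2, Lemma 2.4 p. 572, dictionary] -/
def S0 : ℕ :=
  KP (expFlow q hq) (expFlow_ell_nonneg q) (expFlow_lipschitz q hq) d ℓ hℓ 1 1 1 one_pos * (2 * R0 d q hq hℓ creg β hcreg hβ + 1)

variable (d) in
/-- **A FRAME WITH ROOM** over `e^{tq}`: the base frame upgraded along `FrameR.ofFrame`, `FrameS.ofFrameR` (with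
`S = K(2R+1)`), `FrameV.ofFrameS`. [cite: Balaban1982Higgs2, Lemma 2.4 p. 572, dictionary] -/
def frameV0 : FrameV ι d :=
  FrameV.ofFrameS (FrameS.ofFrameR (FrameR.ofFrame (frame0 d q hq hℓ) hd 0 le_rfl) creg β hcreg hβ
    (S0 d q hq hℓ creg β hcreg hβ))

/-- **`ModelW` IS INHABITED UNCONDITIONALLY**: on the frame with room over `e^{tq}`, for every antisymmetric `q`, every
`d ≥ 1`, `ℓ ≥ 1`, `c_reg ≥ 0`, `β > 0`. [cite: Balaban1982Higgs2, Lemma 2.4 p. 572, dictionary] -/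
theorem modelW_nonempty_frameV0 : Nonempty (ModelW (frameV0 d q hq hd hℓ creg β hcreg hβ)) :=
  modelW_nonempty (frameV0 d q hq hd hℓ creg β hcreg hβ) (show (0 : ℝ) ≤ 1 by norm_num)
    (R := R0 d q hq hℓ creg β hcreg hβ) (le_max_left _ _)
    (show rT (expFlow q hq) (expFlow_ell_nonneg q) (expFlow_lipschitz q hq) d ℓ hℓ 1 1 1 one_pos creg β hcreg hβ
        ≤ ((R0 d q hq hℓ creg β hcreg hβ : ℕ) : ℝ) from
      (Nat.le_ceil _).trans (by exact_mod_cast le_max_right _ _))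
    (show KP (expFlow q hq) (expFlow_ell_nonneg q) (expFlow_lipschitz q hq) d ℓ hℓ 1 1 1 one_pos
        * (2 * R0 d q hq hℓ creg β hcreg hβ + 1) ≤ S0 d q hq hℓ creg β hcreg hβ from le_rfl)

/-- … and its member of the row's family obeys (2.55). [cite: Balaban1982Higgs2, (2.55) p. 570, Lemma 2.4 p. 572, dictionary] -/
theorem exists_member_restr255_frameV0 :
    ∃ m : ModelW (frameV0 d q hq hd hℓ creg β hcreg hβ), m.Ac = (fun _ => 0) ∧ (famOfW _ m).restr255 :=
  exists_member_restr255 (frameV0 d q hq hd hℓ creg β hcreg hβ) (show (0 : ℝ) ≤ 1 by norm_num)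
    (R := R0 d q hq hℓ creg β hcreg hβ) (le_max_left _ _)
    (show rT (expFlow q hq) (expFlow_ell_nonneg q) (expFlow_lipschitz q hq) d ℓ hℓ 1 1 1 one_pos creg β hcreg hβ
        ≤ ((R0 d q hq hℓ creg β hcreg hβ : ℕ) : ℝ) from
      (Nat.le_ceil _).trans (by exact_mod_cast le_max_right _ _))
    (show KP (expFlow q hq) (expFlow_ell_nonneg q) (expFlow_lipschitz q hq) d ℓ hℓ 1 1 1 one_pos
        * (2 * R0 d q hq hℓ creg β hcreg hβ + 1) ≤ S0 d q hq hℓ creg β hcreg hβ from le_rfl)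
    0

/-- … and gen 5's `Model` over its base frame is inhabited for some finite type of outer sites.
[cite: Balaban1982Higgs2, Lemma 2.4 (2.65)–(2.66) p. 572, dictionary] -/
theorem model_nonempty_frameV0 :
    ∃ (Yo : Type) (_ : Fintype Yo) (_ : DecidableEq Yo),
      Nonempty (Model (frameV0 d q hq hd hℓ creg β hcreg hβ).toFrame Yo) :=
  model_nonempty (frameV0 d q hq hd hℓ creg β hcreg hβ) (show (0 : ℝ) ≤ 1 by norm_num)
    (R := R0 d q hq hℓ creg β hcreg hβ) (le_max_left _ _)
    (show rT (expFlow q hq) (expFlow_ell_nonneg q) (expFlow_lipschitz q hq) d ℓ hℓ 1 1 1 one_pos creg β hcreg hβ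
        ≤ ((R0 d q hq hℓ creg β hcreg hβ : ℕ) : ℝ) from
      (Nat.le_ceil _).trans (by exact_mod_cast le_max_right _ _))
    (show KP (expFlow q hq) (expFlow_ell_nonneg q) (expFlow_lipschitz q hq) d ℓ hℓ 1 1 1 one_pos
        * (2 * R0 d q hq hℓ creg β hcreg hβ + 1) ≤ S0 d q hq hℓ creg β hcreg hβ from le_rfl)

end Concrete

/-! ## §4 (v1.1) The regions family on `ηℤ^{d+1}` (`B2Lemma24KerOmega.ModelU`, head pid p340291): a witness on every
frame with room, with `Ω = □₂ = Π[0, K(2R+1))` itself -/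

section Regions

variable [Nonempty ι] (fr : FrameU ι d)

/-- the big blocks of a `FrameU` have size `K ≥ 16`. [cite: Balaban1983RegularityDecay, p. 575 «large blocks, i.e. blocks of the size M», dictionary] -/
theorem sixteen_le_KP1 : 16 ≤ fr.KP1 :=
  (Classical.choose_spec (B4ThmRegionPairEta.region_pair_members fr.F fr.hℓ₁ fr.hLip d fr.ℓ fr.hℓ fr.amin fr.aplus
    fr.m2plus fr.ha)).1

/-- `K > 0` for a `FrameU`. [cite: Balaban1983RegularityDecay, p. 575 «large blocks, i.e. blocks of the size M», dictionary] -/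
theorem KP1_pos : 0 < fr.KP1 := lt_of_lt_of_le (by norm_num) (sixteen_le_KP1 fr)

/-- the smallness threshold `e_θ` for a `FrameU` (same formula). [cite: Balaban1982Higgs2, Lemma 2.4 p. 572 «O((L^kε)^{κ₀})», dictionary] -/
def eθU : ℝ := (1 / (2 * ((d : ℝ) + 1) ^ 2 * fr.S * fr.creg + 1)) ^ (1 / fr.β)

/-- `e_θ > 0`. [cite: Balaban1982Higgs2, Lemma 2.4 p. 572, dictionary] -/
theorem eθU_pos : 0 < eθU fr := by
  unfold eθU
  exact Real.rpow_pos_of_pos (by have := fr.hcreg; positivity) _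

/-- `(d+1)·θ_S(e_θ) ≤ 1` for a `FrameU`. [cite: Balaban1982Higgs2, Lemma 2.4 p. 572 «O((L^kε)^{κ₀})», dictionary] -/
theorem tau_eθU_le : ((d : ℝ) + 1) * thetaS d fr.S fr.creg fr.β (eθU fr) ≤ 1 := by
  have hD0 : 0 ≤ 2 * ((d : ℝ) + 1) ^ 2 * fr.S * fr.creg := by have := fr.hcreg; positivity
  have hpow : (eθU fr) ^ fr.β = 1 / (2 * ((d : ℝ) + 1) ^ 2 * fr.S * fr.creg + 1) := by
    unfold eθU
    rw [← Real.rpow_mul (le_of_lt (by positivity)), one_div_mul_cancel fr.hβ.ne', Real.rpow_one]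
  rw [thetaS, hpow]
  rw [show ((d : ℝ) + 1) * (2 * ((d : ℝ) + 1) * (fr.S : ℝ) * fr.creg
      * (1 / (2 * ((d : ℝ) + 1) ^ 2 * fr.S * fr.creg + 1)))
      = (2 * ((d : ℝ) + 1) ^ 2 * fr.S * fr.creg) / (2 * ((d : ℝ) + 1) ^ 2 * fr.S * fr.creg + 1) by ring]
  exact (div_le_one (by positivity)).2 (by linarith)

/-- the coupling of the regions witness: below `e_NC`, `e_P` and `e_θ`. [cite: Balaban1982Higgs2, Prop. 2.2 p. 570 «for e(L^kε) sufficiently small», dictionary] -/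
def e0U : ℝ := min (min fr.eNC1 fr.eP1) (eθU fr)

/-- `e₀ > 0`. [cite: Balaban1982Higgs2, Prop. 2.2 p. 570, dictionary] -/
theorem e0U_pos : 0 < e0U fr :=
  lt_min (lt_min (eNC_spec fr.F fr.hℓ₁ fr.hLip d fr.ℓ fr.hℓ fr.amin fr.aplus fr.m2plus fr.ha fr.creg fr.β fr.hcreg
      fr.hβ fr.S).1
    (P_spec fr.F fr.hℓ₁ fr.hLip d fr.ℓ fr.hℓ fr.amin fr.aplus fr.m2plus fr.ha fr.creg fr.β fr.hcreg fr.hβ).2.2.2.1)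
    (eθU_pos fr)

/-- `(d+1)·θ_S(e₀) ≤ 1`. [cite: Balaban1982Higgs2, Lemma 2.4 p. 572, dictionary] -/
theorem tau_e0U_le : ((d : ℝ) + 1) * thetaS d fr.S fr.creg fr.β (e0U fr) ≤ 1 := by
  refine le_trans (mul_le_mul_of_nonneg_left ?_ (by positivity)) (tau_eθU_le fr)
  unfold thetaS
  have h1 : (e0U fr) ^ fr.β ≤ (eθU fr) ^ fr.β := Real.rpow_le_rpow (e0U_pos fr).le (min_le_right _ _) fr.hβ.le
  have hc : 0 ≤ 2 * ((d : ℝ) + 1) * (fr.S : ℝ) * fr.creg := by have := fr.hcreg; positivity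
  exact mul_le_mul_of_nonneg_left h1 hc

/-- `θ_S(e₀) ≤ 1`. [cite: Balaban1982Higgs2, Lemma 2.4 p. 572, dictionary] -/
theorem theta_e0U_le : thetaS d fr.S fr.creg fr.β (e0U fr) ≤ 1 :=
  le_trans (le_mul_of_one_le_left (thetaS_nonneg d fr.S fr.hcreg (e0U_pos fr))
    (by linarith [Nat.cast_nonneg (α := ℝ) d])) (tau_e0U_le fr)

/-- the unit box `□₂ = Ω` of the regions witness: `K(2R+1)` unit sites a side. [cite: Balaban1982Higgs2, p. 572 «□₂ … sums of large blocks», dictionary] -/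
def MU (R : ℕ) : Fin (d + 1) → ℕ := fun _ => fr.KP1 * (2 * R + 1)

/-- `M_i ≥ 1`. [cite: Balaban1982Higgs2, Lemma 2.4 p. 572, dictionary] -/
theorem one_le_MU (R : ℕ) (i : Fin (d + 1)) : 1 ≤ MU fr R i :=
  Nat.one_le_iff_ne_zero.2 (Nat.mul_ne_zero (by have := KP1_pos fr; omega) (by omega))

/-- `M_i ≥ 3`. [cite: Balaban1982Higgs2, Lemma 2.4 p. 572, dictionary] -/
theorem three_le_MU (R : ℕ) (i : Fin (d + 1)) : 3 ≤ MU fr R i := by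
  have hK := sixteen_le_KP1 fr
  show 3 ≤ fr.KP1 * (2 * R + 1)
  nlinarith

/-- the block point `y = (R, …, R)` of the regions witness. [cite: Balaban1982Higgs2, Lemma 2.4 p. 572 «y ∈ Λ₇^{(k−1)′}», dictionary] -/
def yU (R : ℕ) : ↥(boxDom (MU fr R)) :=
  ⟨fun _ => (R : ℤ), by
    rw [mem_boxDom]
    intro i
    refine ⟨Int.natCast_nonneg R, ?_⟩
    show (R : ℤ) < ((fr.KP1 * (2 * R + 1) : ℕ) : ℤ)
    have hK : (1 : ℤ) ≤ fr.KP1 := by exact_mod_cast Nat.succ_le_of_lt (KP1_pos fr)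
    have hR : (0 : ℤ) ≤ R := Int.natCast_nonneg R
    push_cast
    nlinarith⟩

/-- the base point `x₀ = 0` of the fine box. [cite: Balaban1982Higgs2, Lemma 2.4 p. 572, dictionary] -/
def x0U (R : ℕ) : ↥(Box d fr.ℓ 1 (MU fr R)) :=
  ⟨fun _ => 0, by
    rw [mem_boxDom]
    intro i
    refine ⟨le_rfl, ?_⟩
    have h1 : 1 ≤ (fr.ℓ + 1) ^ 1 * MU fr R i := Nat.mul_pos (Nat.one_le_pow _ _ (Nat.succ_pos _)) (one_le_MU fr R i)
    exact_mod_cast h1⟩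

/-- the points of the block of `y` are `RL` deep in the fine box (`x_i / L = R`). [cite: Balaban1982Higgs2, Lemma 2.4 p. 572 «x ∈ B^k(y)», dictionary] -/
theorem deepU_of_blkSite (R : ℕ) (x : ↥(Box d fr.ℓ 1 (MU fr R))) (hx : blkSite d fr.ℓ 1 (MU fr R) x = yU fr R)
    (i : Fin (d + 1)) :
    ((R * (fr.ℓ + 1) ^ 1 : ℕ) : ℤ) ≤ x.1 i ∧
      x.1 i + (R * (fr.ℓ + 1) ^ 1 : ℕ) + 1 ≤ (((fr.ℓ + 1) ^ 1 * MU fr R i : ℕ) : ℤ) := by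
  have hb : x.1 i / (((fr.ℓ + 1) ^ 1 : ℕ) : ℤ) = R := by
    have := congrArg (fun y : ↥(boxDom (MU fr R)) => y.1 i) hx
    exact this
  have hn : (0 : ℤ) < (((fr.ℓ + 1) ^ 1 : ℕ) : ℤ) := by positivity
  have h1 : (((fr.ℓ + 1) ^ 1 : ℕ) : ℤ) * (x.1 i / (((fr.ℓ + 1) ^ 1 : ℕ) : ℤ)) ≤ x.1 i := Int.mul_ediv_self_le hn.ne'
  have h3 : x.1 i < (((fr.ℓ + 1) ^ 1 : ℕ) : ℤ) * (x.1 i / (((fr.ℓ + 1) ^ 1 : ℕ) : ℤ)) + (((fr.ℓ + 1) ^ 1 : ℕ) : ℤ) :=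
    Int.lt_mul_ediv_self_add hn
  rw [hb] at h1 h3
  have hK : (1 : ℤ) ≤ fr.KP1 := by exact_mod_cast Nat.succ_le_of_lt (KP1_pos fr)
  have hK' : (((fr.ℓ + 1) ^ 1 : ℕ) : ℤ) * (2 * R + 1) ≤ (((fr.ℓ + 1) ^ 1 : ℕ) : ℤ) * (fr.KP1 * (2 * R + 1)) :=
    mul_le_mul_of_nonneg_left (le_mul_of_one_le_left (by positivity) hK) hn.le
  show _ ∧ _ ≤ ((((fr.ℓ + 1) ^ 1 * (fr.KP1 * (2 * R + 1)) : ℕ) : ℤ))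
  push_cast at h1 h3 hn hK' ⊢
  simp only [pow_one] at h1 h3 hn hK' ⊢
  constructor
  · nlinarith
  · nlinarith

/-- **THE REGIONS WITNESS**: on a `FrameU` with `m²₊ ≥ 0` and room `K(2R+1) ≤ S` for some `R ≥ max(1, R₀)`, the instance of
`B2Lemma24KerOmega.ModelU` with `k = 1`, `(a, m²) = (a₋, 0)`, `Ω = □₂ = Π[0, K(2R+1)) ⊂ ηℤ^{d+1}` at `o = 0` (`□ = B^k(Λ₂′)`
itself, a union of big blocks), `Λ₆′ = Λ₂′`, the constant component field `A ≡ c`, the coupling `e₀`, `y = (R,…,R)`,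
`□₁ = {y}`, `φ ≡ 0`, scales `0`, depth `R`. [cite: Balaban1982Higgs2, (2.55)–(2.56) p. 570, Lemma 2.4 p. 572, dictionary] -/
def witnessU (hm : 0 ≤ fr.m2plus) {R : ℕ} (hR1 : 1 ≤ R) (hRP : fr.rP1 ≤ R) (hS : fr.KP1 * (2 * R + 1) ≤ fr.S)
    (c : Fin (d + 1) → ℝ) : ModelU fr where
  k := 1
  hk := le_rfl
  a := fr.amin
  m2 := 0
  ha1 := le_rfl
  ha2 := fr.hwin
  hm1 := le_rfl
  hm2 := hm
  M := MU fr R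
  hM := one_le_MU fr R
  hMS := fun _ => hS
  hM3 := fun i => le_trans (three_le_MU fr R i) (Nat.le_mul_of_pos_left _ (Nat.one_le_pow _ _ (Nat.succ_pos _)))
  o := 0
  Ω₀c := boxDom (MU fr R)
  hbox := fun y => by simpa only [add_zero] using y.2
  hbigΩ := boxDom_isBlockUnion (Nat.succ_le_of_lt (KP1_pos fr)) _
  hbigB := isBlockUnion_boxLabels_zero (Nat.succ_le_of_lt (KP1_pos fr)) (fun _ => Dvd.intro _ rfl)
  e := e0U fr
  he := e0U_pos fr
  hle := (min_le_left _ _).trans (min_le_left _ _)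
  hleP := (min_le_left _ _).trans (min_le_right _ _)
  hθ1 := theta_e0U_le fr
  hτ1 := tau_e0U_le fr
  Ac := fun _ => c
  hreg := by
    intro x _ μ ν
    simp only [sub_self, abs_zero]
    exact div_nonneg (mul_nonneg fr.hcreg (Real.rpow_nonneg (e0U_pos fr).le _)) (Nat.cast_nonneg _)
  x₀ := x0U fr R
  y := yU fr R
  sq1 := {yU fr R}
  y_mem := Finset.mem_singleton_self _
  φΩ := fun _ _ => 0
  p := 0
  q := 0
  tφ := 0
  R₁ := 0
  R₂ := 0
  R₄ := 0
  p_nonneg := le_rfl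
  q_nonneg := le_rfl
  tφ_nonneg := le_rfl
  R₂_nonneg := le_rfl
  q_le := by rw [mul_zero]
  kap := by rw [mul_zero]; exact fr.K₁_nonneg
  sepG := by rw [mul_zero]; exact fr.K₂_nonneg
  sepD := by rw [mul_zero]; exact fr.K₂_nonneg
  sepO₂ := by rw [mul_zero]; exact fr.K₄_nonneg
  sepO₄ := by rw [mul_zero]; exact fr.K₅_nonneg
  θ_scale := by rw [mul_zero]; exact fr.Kθ_nonneg
  τ_scale := by rw [mul_zero]; exact fr.Kτ_nonneg
  θ'_scale := by rw [mul_zero]; exact fr.Kθ'_nonneg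
  far1 := fun _ _ _ _ => div_nonneg (supNorm_nonneg _) (Nat.cast_nonneg _)
  Tout := Finset.univ
  inc_mem := fun _ _ => Finset.mem_univ _
  farΩ := fun _ _ _ _ _ => supNorm_nonneg _
  R := R
  hR1 := hR1
  deep := deepU_of_blkSite fr R
  hRP := hRP
  hR4 := Nat.cast_nonneg _

/-- **THE REGIONS WITNESS SATISFIES (2.55)**: `(famOfU fr (witnessU …)).restr255`. [cite: Balaban1982Higgs2, (2.55) p. 570, Lemma 2.4 p. 572, dictionary] -/
theorem witnessU_restr255 (hm : 0 ≤ fr.m2plus) {R : ℕ} (hR1 : 1 ≤ R) (hRP : fr.rP1 ≤ R)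
    (hS : fr.KP1 * (2 * R + 1) ≤ fr.S) (c : Fin (d + 1) → ℝ) : (famOfU fr (witnessU fr hm hR1 hRP hS c)).restr255 :=
  modelR_restr_of_single _ rfl (fun y' _ => by
    show siteNorm (fun _ : ι => (0 : ℝ)) ≤ 0 * 0
    rw [mul_zero]
    exact le_of_eq (B4Lemma22Reduce231.siteNorm_zero))

/-- **`ModelU fr` IS INHABITED** on every `FrameU` with `m²₊ ≥ 0` and room for one box, WITH A MEMBER INSIDE (2.55).
[cite: Balaban1982Higgs2, Lemma 2.4 p. 572, dictionary] -/
theorem exists_memberU_restr255 (hm : 0 ≤ fr.m2plus) {R : ℕ} (hR1 : 1 ≤ R) (hRP : fr.rP1 ≤ R)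
    (hS : fr.KP1 * (2 * R + 1) ≤ fr.S) (c : Fin (d + 1) → ℝ) :
    ∃ m : ModelU fr, m.Ac = (fun _ => c) ∧ (famOfU fr m).restr255 :=
  ⟨_, rfl, witnessU_restr255 fr hm hR1 hRP hS c⟩

/-- `ModelU fr` is nonempty. [cite: Balaban1982Higgs2, Lemma 2.4 p. 572, dictionary] -/
theorem modelU_nonempty (hm : 0 ≤ fr.m2plus) {R : ℕ} (hR1 : 1 ≤ R) (hRP : fr.rP1 ≤ R)
    (hS : fr.KP1 * (2 * R + 1) ≤ fr.S) : Nonempty (ModelU fr) := ⟨witnessU fr hm hR1 hRP hS 0⟩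

end Regions

section ConcreteRegions

variable [Nonempty ι] (q : Matrix ι ι ℝ) (hq : qᵀ = -q) (hd : 1 ≤ d) {ℓ : ℕ} (hℓ : 1 ≤ ℓ)
  (creg β : ℝ) (hcreg : 0 ≤ creg) (hβ : 0 < β)

variable (d) in
/-- the depth `R = max(1, ⌈R₀⌉)` for the regions family over the base data (`R₀ = rP` of (2.58) for region pairs).
[cite: Balaban1982Higgs2, Prop. 2.2 (2.58) p. 570; p. 571 «dist(b, Ω^c) ≧ R₀», dictionary] -/
def R0U : ℕ :=
  max 1 ⌈rP (expFlow q hq) (expFlow_ell_nonneg q) (expFlow_lipschitz q hq) d ℓ hℓ 1 1 1 one_pos creg β hcreg hβ⌉₊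

variable (d) in
/-- the box-size bound `S = K(2R+1)` for the regions family. [cite: Balaban1982Higgs2, Lemma 2.4 p. 572, dictionary] -/
def S0U : ℕ :=
  KP (expFlow q hq) (expFlow_ell_nonneg q) (expFlow_lipschitz q hq) d ℓ hℓ 1 1 1 one_pos
    * (2 * R0U d q hq hℓ creg β hcreg hβ + 1)

variable (d) in
/-- **A `FrameU` WITH ROOM** over `e^{tq}`: `frame0` upgraded along `FrameR.ofFrame`, `FrameS.ofFrameR` (`S := K(2R+1)`),
`FrameU.ofFrameS`. [cite: Balaban1982Higgs2, Lemma 2.4 p. 572, dictionary] -/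
def frameU0 : FrameU ι d :=
  FrameU.ofFrameS (FrameS.ofFrameR (FrameR.ofFrame (frame0 d q hq hℓ) hd 0 le_rfl) creg β hcreg hβ
    (S0U d q hq hℓ creg β hcreg hβ))

/-- **`ModelU` IS INHABITED UNCONDITIONALLY, WITH A MEMBER INSIDE (2.55)**, on the `FrameU` with room over `e^{tq}`.
[cite: Balaban1982Higgs2, (2.55) p. 570, Lemma 2.4 p. 572, dictionary] -/
theorem exists_memberU_restr255_frameU0 :
    ∃ m : ModelU (frameU0 d q hq hd hℓ creg β hcreg hβ), m.Ac = (fun _ => 0) ∧ (famOfU _ m).restr255 :=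
  exists_memberU_restr255 (frameU0 d q hq hd hℓ creg β hcreg hβ) (show (0 : ℝ) ≤ 1 by norm_num)
    (R := R0U d q hq hℓ creg β hcreg hβ) (le_max_left _ _)
    (show rP (expFlow q hq) (expFlow_ell_nonneg q) (expFlow_lipschitz q hq) d ℓ hℓ 1 1 1 one_pos creg β hcreg hβ
        ≤ ((R0U d q hq hℓ creg β hcreg hβ : ℕ) : ℝ) from
      (Nat.le_ceil _).trans (by exact_mod_cast le_max_right _ _))
    (show KP (expFlow q hq) (expFlow_ell_nonneg q) (expFlow_lipschitz q hq) d ℓ hℓ 1 1 1 one_pos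
        * (2 * R0U d q hq hℓ creg β hcreg hβ + 1) ≤ S0U d q hq hℓ creg β hcreg hβ from le_rfl)
    0

end ConcreteRegions

end

end Literature.MathematicalPhysics.QuantumFieldTheory.Balaban1983to89.B2Lemma24ModelWitness
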